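import Mathlib
import Summits.Ventures.HodgeRepro2.T5DeltaTwistBilinForm
import Summits.Ventures.HodgeRepro2.T5CMSymplectic

/-!
# T5BilinFormBaseChange — a symplectic form stays symplectic under base change

Tier-5 sub-step N2, §N2.9.2 of route/T5-N2-route-3.md (l. 63): the symplectic space
`tr_{E/F}(δ⁻¹⟨·,·⟩ ⊗ δ(·,·)) = tr_{E/F}(⟨·,·⟩ ⊗ (·,·))` on the CM field (files 92 / 94 / 96 of
route/LEAN-ANNEX-p3.md) is used in the route AFTER COMPLETION at a place `v` of `F = K⁺`, i.e.
after the base change `F → F_v`.  This file supplies the elementary half of that step, for an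
arbitrary base change `R → A` of an `R`-bilinear form on an `R`-module `M`
(Mathlib's `LinearMap.BilinForm.baseChange`):

* the base change of a skew form is skew (`flip_baseChange_eq_neg`, `baseChange_apply_eq_neg`);
* the base change of an alternating form is alternating (`IsAlt.baseChange`);
* the Gram matrix of the base change is the image of the Gram matrix (`toMatrix_baseChange`);
* for a field extension `K / F` and a finite-dimensional `F`-space, the base change of a
  non-degenerate form is non-degenerate (`Nondegenerate.baseChange`) and the dimension is
  unchanged (`finrank_baseChange`);
* hence a symplectic (= alternating and non-degenerate) form stays symplectic
  (`isAlt_and_nondegenerate_baseChange`), in particular §N2.9.2's form on the CM field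
  (`isAlt_and_nondegenerate_traceBilin_baseChange`, `finrank_traceBilin_baseChange`: dimension 12
  for the datum's `3 × 2` Gram shape).

What STAYS PROSE of §N2.9.2's completion step: the identification of the base change
`F_v ⊗_F (ι × κ → E)` with `ι × κ → E_v` for `E_v = E ⊗_F F_v` (a product of fields at a split
place), and that the base-changed form is again the trace form of `E_v / F_v` — Kudla's splitting
is a printed input and is not touched here.

Everything is over Mathlib's `LinearMap.BilinForm`; no new definition is introduced.
-/

namespace Summit.Ventures.HodgeRepro2.T5BilinFormBaseChange

open TensorProduct

section CommRing

variable {R A M : Type*} [CommRing R] [CommRing A] [Algebra R A] [AddCommGroup M] [Module R M]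
variable {B : LinearMap.BilinForm R M}

/-- The base change of a skew-symmetric bilinear form is skew-symmetric:
`(B ⊗ A) x y = -(B ⊗ A) y x` for all `x y : A ⊗[R] M`. -/
theorem baseChange_apply_eq_neg (hB : ∀ x y, B x y = -B y x) (x y : A ⊗[R] M) :
    B.baseChange A x y = -(B.baseChange A y x) := by
  induction x using TensorProduct.induction_on with
  | zero => simp
  | tmul a m =>
    induction y using TensorProduct.induction_on with
    | zero => simp
    | tmul b n =>
      simp only [LinearMap.BilinForm.baseChange_tmul, hB m n, neg_smul, mul_comm a b]
    | add y₁ y₂ h₁ h₂ => rw [map_add, map_add, LinearMap.add_apply, h₁, h₂, neg_add]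
  | add x₁ x₂ h₁ h₂ => rw [map_add, LinearMap.add_apply, map_add, h₁, h₂, neg_add]

/-- `baseChange_apply_eq_neg` as an identity of bilinear forms: `(B ⊗ A).flip = -(B ⊗ A)`. -/
theorem flip_baseChange_eq_neg (hB : ∀ x y, B x y = -B y x) :
    (B.baseChange A).flip = -(B.baseChange A) :=
  LinearMap.ext₂ fun x y => by
    simp only [LinearMap.BilinForm.flip_apply, LinearMap.neg_apply]
    exact baseChange_apply_eq_neg hB y x

/-- The base change of an alternating bilinear form is alternating. -/
theorem IsAlt.baseChange (hB : B.IsAlt) : (B.baseChange A).IsAlt := by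
  have hskew : ∀ x y, B x y = -B y x := fun x y => (LinearMap.IsAlt.neg hB y x).symm
  intro x
  induction x using TensorProduct.induction_on with
  | zero => simp
  | tmul a m => simp [LinearMap.BilinForm.baseChange_tmul, hB m]
  | add y z hy hz =>
    simp only [map_add, LinearMap.add_apply, hy, hz, zero_add, add_zero,
      baseChange_apply_eq_neg hskew y z, add_neg_cancel]

variable {ι : Type*} [Fintype ι] [DecidableEq ι]

/-- The Gram matrix of the base change in the base-changed basis is the image of the Gram
matrix under `algebraMap R A`. -/
theorem toMatrix_baseChange (b : Module.Basis ι R M) :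
    LinearMap.BilinForm.toMatrix (b.baseChange A) (B.baseChange A) =
      (LinearMap.BilinForm.toMatrix b B).map (algebraMap R A) := by
  ext i j
  simp only [LinearMap.BilinForm.toMatrix_apply, Module.Basis.baseChange_apply,
    LinearMap.BilinForm.baseChange_tmul, mul_one, Matrix.map_apply, Algebra.algebraMap_eq_smul_one]

/-- The determinant of the Gram matrix of the base change is the image of the determinant of the
Gram matrix. -/
theorem det_toMatrix_baseChange (b : Module.Basis ι R M) :
    (LinearMap.BilinForm.toMatrix (b.baseChange A) (B.baseChange A)).det =
      algebraMap R A (LinearMap.BilinForm.toMatrix b B).det := by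
  rw [toMatrix_baseChange, RingHom.map_det, RingHom.mapMatrix_apply]

end CommRing

section Field

variable {F K V : Type*} [Field F] [Field K] [Algebra F K] [AddCommGroup V] [Module F V]
  [FiniteDimensional F V]

/-- For a field extension `K / F` and a finite-dimensional `F`-space `V`, the base change of a
non-degenerate bilinear form on `V` is non-degenerate on `K ⊗[F] V`. -/
theorem Nondegenerate.baseChange {B : LinearMap.BilinForm F V} (hB : B.Nondegenerate) :
    (B.baseChange K).Nondegenerate := by
  let b := Module.finBasis F V
  rw [LinearMap.BilinForm.nondegenerate_iff_det_ne_zero (b.baseChange K),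
    det_toMatrix_baseChange]
  exact (map_ne_zero (algebraMap F K)).mpr
    ((LinearMap.BilinForm.nondegenerate_iff_det_ne_zero b).mp hB)

/-- The base change does not change the dimension: `dim_K (K ⊗[F] V) = dim_F V`. -/
theorem finrank_baseChange : Module.finrank K (K ⊗[F] V) = Module.finrank F V :=
  Module.finrank_baseChange

/-- A symplectic form (alternating and non-degenerate) on a finite-dimensional `F`-space stays
symplectic after base change to any field extension `K / F`. -/
theorem isAlt_and_nondegenerate_baseChange {B : LinearMap.BilinForm F V}
    (hB : B.IsAlt ∧ B.Nondegenerate) :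
    (B.baseChange K).IsAlt ∧ (B.baseChange K).Nondegenerate :=
  ⟨IsAlt.baseChange hB.1, Nondegenerate.baseChange hB.2⟩

end Field

section CMField

open NumberField T5DeltaTwistBilinForm

variable (K : Type*) [Field K] [NumberField K] [IsCMField K]
variable {ι κ : Type*} [Fintype ι] [Fintype κ]

/-- §N2.9.2 after base change: for a CM field `K` with maximal real subfield `K⁺`, a hermitian
`M` and a skew-hermitian `N` with unit determinants, the symplectic `K⁺`-form
`tr_{K/K⁺}(⟨·,·⟩_M ⊗ (·,·)_N)` of file 96 stays alternating and non-degenerate after base change to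
ANY field `L` over `K⁺` — e.g. a completion `K⁺_v`. -/
theorem isAlt_and_nondegenerate_traceBilin_baseChange [DecidableEq ι] [DecidableEq κ]
    {M : Matrix ι ι K} {N : Matrix κ κ K}
    (hM : M.conjTranspose = M) (hN : N.conjTranspose = -N) (hdM : IsUnit M.det)
    (hdN : IsUnit N.det) (L : Type*) [Field L] [Algebra (maximalRealSubfield K) L] :
    ((traceBilin (T5CMSymplectic.star_algebraMap K)
        (Matrix.kroneckerMap (fun x1 x2 => x1 * x2) M N)).baseChange L).IsAlt ∧
      ((traceBilin (T5CMSymplectic.star_algebraMap K)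
        (Matrix.kroneckerMap (fun x1 x2 => x1 * x2) M N)).baseChange L).Nondegenerate :=
  isAlt_and_nondegenerate_baseChange
    (T5CMSymplectic.isAlt_and_nondegenerate_traceBilin K hM hN hdM hdN)

/-- The base-changed symplectic space of §N2.9.2 has `L`-dimension `#ι · #κ · 2`; for the datum's
`3 × 2` shape this is `12` (`finrank_traceBilin_baseChange_three_two`). -/
theorem finrank_traceBilin_baseChange (L : Type*) [Field L]
    [Algebra (maximalRealSubfield K) L] :
    Module.finrank L (L ⊗[maximalRealSubfield K] (ι × κ → K)) =
      Fintype.card ι * Fintype.card κ * 2 := by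
  rw [finrank_baseChange, T5CMSymplectic.finrank_tensorSpace K]

/-- The datum's completed symplectic space has dimension `12` over the completion. -/
theorem finrank_traceBilin_baseChange_three_two (L : Type*) [Field L]
    [Algebra (maximalRealSubfield K) L] :
    Module.finrank L (L ⊗[maximalRealSubfield K] (Fin 3 × Fin 2 → K)) = 12 := by
  rw [finrank_baseChange, T5CMSymplectic.finrank_tensorSpace_three_two K]

end CMField

end Summit.Ventures.HodgeRepro2.T5BilinFormBaseChange
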